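import Summits.QuantumFields.YangMills.Theorems.FluctuationComparisonRegPrIntLSupTailCoverUnionPrintedLeaf
import Summits.QuantumFields.YangMills.Theorems.FluctuationComparisonRegPrIntLSupTailFloorOfWreg
import Summits.QuantumFields.YangMills.Theorems.ReplicaVarianceTiltHeightChiSqLAcIntegrable
import HarnessLib

/-!
# `FluctuationComparisonRegPrIntLSupTailFloorDepthOne` — THE SMALL-`J` FLOOR OF THE TAILSUP₁∘ LANE AT DEPTH ONE, UNCONDITIONALLY; hence
# TAILSUP₁∘ `WindowOddsSupDepthOneIntCan` ⟸ ONE fibrewise per-plaquette tail in print's currency (no floor letter left)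
# (crux `UnitScaleTilt.FluctuationComparisonRegPrIntL`, stmt-QuantumFields-20520; companion of ✓`…SupTailFloorOfWreg` (px21 g13: the floor from WREG modulo ONE domination
# letter), ✓`…SupTailCoverUnionPrintedLeaf` (the leaf: fibre tail + floor ⇒ TAILSUP₁∘), and the `ReplicaVarianceTilt`∕`HeightChiSqL` series of stmt-QuantumFields-26133
# (`…HeightChiSqLAcIntegrable`, `…OfFibreLawBound`, `…EmlFibreLawBound`: the guarded exp-mean-log fibre laws on `SU(2)` are dominated by Haar measure))

Cell `ym3-torus` (YM ladder rung R3 = continuum SU(2) Yang–Mills on T³ — a RUNG, NOT the Clay problem: not d = 4, not infinite volume, not a mass gap);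
width seat `ym3-torus-px20` (gen 11); helper `--supports stmt-QuantumFields-20520`.  THEOREMS ONLY (0 `def`, 0 `sorry`, default heartbeats).

WHAT.  ✓`…SupTailFloorOfWreg.floor_of_wreg` (px21 g13, 2026-08-30) proves the small-`J` FLOOR of the TAILSUP₁∘ doors — `∃ q > 0, ∀ B` measurable inside the interior window
`W_J(c·b₀)`, `ofReal q·Gibbs_K(D_{J,K}⁻¹B) ≤ Gibbs_K(D_{J,K}⁻¹B ∩ histGood(θBal b₀) K J)` — from the landed organ WREG, MODULO ONE LETTER: the setwise DOMINATION of the descended law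
by product Haar, `Gibbs_K(D_{J,K}⁻¹B) ≤ ofReal C·dU_J(B)`.  AT DEPTH ONE (`K = J+1`) THAT LETTER IS A THEOREM OF THE TREE: the `HeightChiSqL` series of the route `ReplicaVarianceTilt`
(stmt-QuantumFields-26133; width seat `ym-line-sfw-p2-w3` g21) proved that the guarded exp-mean-log fibre laws of Bałaban's averaging (0.4) on `SU(2)` are dominated by Haar measure
uniformly in the frozen holonomies (`HeightChiSqL.guardedFibreLaw_le_smul` ⟸ `HeightChiSqLEmlFibreLawBound.exists_eml_fibre_le_smul`: Jacobian floor from `T4EMLTangentInjective` by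
compactness + a finite injectivity cover + the change of variables through the charts of `T4HaarUnitaryLocalDiffeo`), and that dominated guarded fibre laws give a dominated image
law of one (0.4) step (`HeightChiSqLOfFibreLawBound.map_fieldMeasure_avgFun_le_of_guard`, the bounded triangular push-forward in the private coordinates `centralBond`).
* §1 ★★`map_descendTo_succ_gibbsK_le_smul` — for `γ ≥ 0` and every `J`: `∃ C ≠ ⊤, (D_{J,J+1})_*Gibbs_{J+1} ≤ C • dU_J` (lit `descendTo_succ`: `D_{J,J+1} = fieldShift ∘ Ū`;
  `Gibbs = Z⁻¹·dU.withDensity e^{−βA} ≤ Z⁻¹·dU`; the two tree theorems; lit `measurePreserving_fieldShift`) · ★★`dominated_depthOne` — the letter of ✓`floor_of_wreg` at `K = J+1`,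
  for EVERY measurable `B` (no window): `∃ C > 0, Gibbs_{J+1}(D⁻¹B) ≤ ofReal C·dU_J(B)`.
* §2 ★★★`floor_depthOne` — **FLOOR₁∘(J) UNCONDITIONALLY**: `∀ L b₀ p₀ (0 < b₀) (0 < p₀), ∃ γ₁ > 0` (WREG's, capped at `1`), `∀ F γ (F.L = L) (0 < γ ≤ γ₁) J c (0 < c < 1), ∃ q > 0,
  ∀ B` measurable `⊆ W_J(c·b₀)`: `ofReal q·Gibbs_{J+1}(D⁻¹B) ≤ Gibbs_{J+1}(D⁻¹B ∩ histGood(θBal b₀) (J+1) J)` (✓`floor_of_wreg` at `K := J+1` ∘ §1).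
* §3 ★★★`condGoodOddsDepthOneInt_of_fibreTailPrinted` ∕ ★★★`windowOddsSupDepthOneInt_of_fibreTailPrinted` — THE LEAF WITHOUT THE FLOOR (one regime; §4 (v1.1): the two-regime
  fibrewise twin `…_of_fibreTailPrinted_linearMoment` for a (TAIL) hand confined to a chart radius `δ₀ ≤ 2`, also without the floor): hypothesis = TAILSUP₁∘'s quantifier prefix,
  then (after `F, γ`) constants `C` (any sign), `A : ℕ`, `cT > 0` and (TAIL₁) ONLY — for every `J`, `p ∈ T_{J+1}`, for `(dU_{J+1}.map D)`-a.e. datum `V` in the interior window: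
  `∫⁻_{θBal_{J+1}(b₀) ≤ dist1 U(∂p)} boltzmann dκ_V ≤ ofReal(C·β_{J+1}^A·e^{−cT·p(g_{J+1})²})·∫⁻ boltzmann dκ_V` ⇒ ✓K's ⟨COND-ODDS₁∘⟩ ∕ TAILSUP₁∘ verbatim (✓`…PrintedLeaf`'s leaf with
  its FLOOR conjunct supplied by §2; `c₀ ↦ min c₀ ½` so that `c < 1`, `γ₁ ↦ min γ₁ γ₁^{WREG}`).
SO THE HAND'S RESIDUE FOR TAILSUP₁∘ IS NOW ONE LETTER: the per-plaquette moderate window-exit fraction of the Boltzmann-tilted conditional Haar law one level deep, in print's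
currency `C·β^A·e^{−c·p(g)²}` — [Balaban1985UV3] (38)–(40) p. 266 ∕ (71) p. 273 per plaquette (chart + convexity; no hand yet).
HONEST SCOPE.  Measure bookkeeping over LANDED theorems (WREG, px21's floor door, the `HeightChiSqL` domination series, the arithmetic of ✓`…SupTailCoverUnionEventual`); (TAIL₁) is
the HYPOTHESIS of §3 and is NOT proved; TAILSUP₁∘, MOD₁∘, FAR₁, LFR♯ᶜ∘, S2β, 20520, `YM3TorusSU2` NOT proved; the Yang–Mills mass gap is NOT proved.  Nothing here is
`K`-uniform (`q` depends on `(F, γ, J, c)`; at depth one nothing `K`-uniform is needed).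
HYP-SAT (cell RULING №42).  §1–§2 are hypothesis-free on the literal T³ families (every `F`, `γ` in WREG's range, every `J`); §3's only letter (`C, A, cT` after `F, γ`; (TAIL₁) per
plaquette, relative to the fibre's own Boltzmann mass — no volume factor, no small-`J` obstruction) is satisfiable at the true quantifier order modulo its analytic content.
References: [Balaban1985UV3] (2) p. 256, (5) p. 256, (7) p. 257, (38)–(40) p. 266, (71) p. 273; [Balaban1987RG1] (0.4), (0.11) p. 253; [Balaban1985Averaging] (10) p. 19;
[King1986] §3.2 p. 656.
-/

noncomputable section

set_option autoImplicit false

open MeasureTheory ProbabilityTheory Filter Topology Set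
open scoped ENNReal NNReal BigOperators
open Literature.MathematicalPhysics.QuantumFieldTheory.Balaban1983to89
open Literature.MathematicalPhysics.QuantumFieldTheory.Balaban1983to89.T3ContinuumYM3Torus
open Literature.MathematicalPhysics.QuantumFieldTheory.Balaban1983to89.T3LevelShift
open Literature.MathematicalPhysics.QuantumFieldTheory.Balaban1983to89.T3NestedUnitLaws
open Literature.MathematicalPhysics.QuantumFieldTheory.Balaban1983to89.T3UnitLawDensityEML
open Literature.MathematicalPhysics.QuantumFieldTheory.Balaban1983to89.T3UnitScaleTilt
open Literature.MathematicalPhysics.QuantumFieldTheory.Balaban1983to89.T3TiltDescent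
open Literature.MathematicalPhysics.QuantumFieldTheory.Balaban1983to89.T3OneStepAveragingPlaquettes (descendTo_succ)
open Literature.MathematicalPhysics.QuantumFieldTheory.Balaban1983to89.Missing
open Literature.MathematicalPhysics.QuantumFieldTheory.Balaban1983to89.T4AveragingDisintegration
open Literature.MathematicalPhysics.QuantumFieldTheory.Balaban1983to89.BlockAveraging
open scoped Literature.MathematicalPhysics.QuantumFieldTheory.Balaban1983to89.T3OrbitAverage
open Summit.QuantumFields.YangMills.Theorems.FluctuationComparisonRegPrIntLWregGlue (heightDensityCan)
open Summit.QuantumFields.YangMills.Theorems.FluctuationComparisonRegPrIntLSupTailFloorOfWreg (floor_of_wreg)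
open Summit.QuantumFields.YangMills.Theorems.FluctuationComparisonRegPrIntLSupTailCoverUnionPrintedLeaf (condGoodOddsDepthOneInt_of_fibreTailPrinted_floor)

namespace Summit.QuantumFields.YangMills.Theorems.FluctuationComparisonRegPrIntLSupTailFloorDepthOne

/-! ## §1 The one-step descended Gibbs law is dominated by product Haar -/

section Domination

variable (F : T3Family) {γ : ℝ}

/-- ★★ **THE ONE-STEP DESCENDED GIBBS LAW IS DOMINATED BY PRODUCT HAAR**: for `γ ≥ 0` and every level `J` there is `C ≠ ⊤` with
`(D_{J,J+1})_*Gibbs_{J+1} ≤ C • dU_J`.  Proof: `D_{J,J+1} = fieldShift ∘ Ū` (lit `descendTo_succ`); `Gibbs_{J+1} = Z⁻¹·dU.withDensity e^{−β_{J+1}A} ≤ Z⁻¹·dU` (`e^{−βA} ≤ 1`);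
`Ū_* dU ≤ (C′+1)^{#bonds} • dU` by the tree's `HeightChiSqLOfFibreLawBound.map_fieldMeasure_avgFun_le_of_guard` fed with `HeightChiSqL.guardedFibreLaw_le_smul` (the guarded exp-mean-log
fibre laws on `SU(2)` are dominated by Haar, stmt-26133's series); `fieldShift` preserves product Haar (lit `measurePreserving_fieldShift`).
[cite: Balaban1987RG1, (0.4) and (0.11) p.253; Balaban1985Averaging, (10) p.19] -/
theorem map_descendTo_succ_gibbsK_le_smul (hγ : 0 ≤ γ) (J : ℕ) :
    ∃ C : ℝ≥0∞, C ≠ ⊤ ∧ Measure.map (descendTo F ℰp J (J + 1) (Nat.le_succ J)) (gibbsK F ℰp γ (J + 1)) ≤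
      C • fieldMeasure (F.P J) 0 (Matrix.specialUnitaryGroup (Fin 2) ℂ) := by
  -- the dominated image law of one (0.4) step on the finest lattice of the `(J+1)`-th approximation
  obtain ⟨C, hC, hle⟩ := HeightChiSqL.guardedFibreLaw_le_smul F J
  have hj : 0 + 1 ≤ (F.P (J + 1)).m + (F.P (J + 1)).K := by show 0 + 1 ≤ F.m + (J + 1); omega
  have himg := HeightChiSqLOfFibreLawBound.map_fieldMeasure_avgFun_le_of_guard (P := F.P (J + 1)) (j := 0) hj ℰp measurableE_ℰp hle
  set N : ℝ≥0∞ := (C + 1) ^ Fintype.card (PBond (F.P (J + 1)) 1) with hN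
  have hNt : N ≠ ⊤ := ENNReal.pow_ne_top (ENNReal.add_ne_top.mpr ⟨hC, ENNReal.one_ne_top⟩)
  -- the partition function
  set Z : ℝ≥0∞ := ENNReal.ofReal (partitionFn (G := Matrix.specialUnitaryGroup (Fin 2) ℂ) (F.P (J + 1)) ((F.scheme ℰp γ).β (J + 1))) with hZ
  have hZ0 : Z ≠ 0 := (ENNReal.ofReal_pos.mpr (partitionFn_pos' _ (F.scheme_β_nonneg ℰp hγ (J + 1)))).ne'
  refine ⟨Z⁻¹ * N, ENNReal.mul_ne_top (ENNReal.inv_ne_top.mpr hZ0) hNt, ?_⟩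
  -- `Gibbs_{J+1} ≤ Z⁻¹ • dU` setwise
  have hgibbs : ∀ s : Set (GaugeField (F.P (J + 1)) 0 (Matrix.specialUnitaryGroup (Fin 2) ℂ)),
      gibbsK F ℰp γ (J + 1) s ≤ Z⁻¹ * fieldMeasure (F.P (J + 1)) 0 (Matrix.specialUnitaryGroup (Fin 2) ℂ) s := by
    intro s
    have hwd : (fieldMeasure (F.P (J + 1)) 0 (Matrix.specialUnitaryGroup (Fin 2) ℂ)).withDensity
        (fun U => ENNReal.ofReal (boltzmann (F.P (J + 1)) ((F.scheme ℰp γ).β (J + 1)) U)) ≤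
        fieldMeasure (F.P (J + 1)) 0 (Matrix.specialUnitaryGroup (Fin 2) ℂ) := by
      have h1 := withDensity_mono (μ := fieldMeasure (F.P (J + 1)) 0 (Matrix.specialUnitaryGroup (Fin 2) ℂ))
        (f := fun U => ENNReal.ofReal (boltzmann (F.P (J + 1)) ((F.scheme ℰp γ).β (J + 1)) U)) (g := 1)
        (ae_of_all _ fun U => ENNReal.ofReal_le_one.mpr (boltzmann_le_one _ (F.scheme_β_nonneg ℰp hγ (J + 1)) U))
      rwa [withDensity_one] at h1
    show T4GenFunBounds.gibbsMeasure (F.P (J + 1)) ((F.scheme ℰp γ).β (J + 1)) s ≤ _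
    rw [T4GenFunBounds.gibbsMeasure, Measure.smul_apply, smul_eq_mul]
    exact mul_le_mul' le_rfl (Measure.le_iff'.mp hwd s)
  -- `Ū_* dU ≤ N • dU` with `Ū` spelled as the scheme's block averaging
  have himg' : Measure.map (BlockAveraging.blockAvg (P := F.P (J + 1)) (j := 0) ℰp).avg
      (fieldMeasure (F.P (J + 1)) 0 (Matrix.specialUnitaryGroup (Fin 2) ℂ)) ≤
      N • fieldMeasure (F.P (J + 1)) 1 (Matrix.specialUnitaryGroup (Fin 2) ℂ) := by
    rw [blockAvg_avg]; exact himg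
  -- `D_{J,J+1} = fieldShift ∘ Ū` (lit `descendTo_succ`), `fieldShift` preserves product Haar: the image of `dU` under `D_{J,J+1}` is dominated, setwise
  have hsh : (F.PP F.m J).sitesPerDir 0 = (F.PP F.m (J + 1)).sitesPerDir 1 :=
    F.sitesPerDir_eq (m := F.m) (K := J) (j := 0) (m' := F.m) (K' := J + 1) (j' := 1) (by omega)
  have hD : Measurable (descendTo F ℰp J (J + 1) (Nat.le_succ J)) := measurable_descendTo F ℰp measurableE_ℰp (Nat.le_succ J)
  have hdU : ∀ s : Set (GaugeField (F.P J) 0 (Matrix.specialUnitaryGroup (Fin 2) ℂ)), MeasurableSet s →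
      fieldMeasure (F.P (J + 1)) 0 (Matrix.specialUnitaryGroup (Fin 2) ℂ) (descendTo F ℰp J (J + 1) (Nat.le_succ J) ⁻¹' s) ≤
        N * fieldMeasure (F.P J) 0 (Matrix.specialUnitaryGroup (Fin 2) ℂ) s := by
    intro s hs
    have hT : MeasurableSet ((fieldShift hsh : GaugeField (F.PP F.m (J + 1)) 1 (Matrix.specialUnitaryGroup (Fin 2) ℂ) →
        GaugeField (F.PP F.m J) 0 (Matrix.specialUnitaryGroup (Fin 2) ℂ)) ⁻¹' s) :=
      measurable_fieldShift (G := Matrix.specialUnitaryGroup (Fin 2) ℂ) hsh hs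
    have hpre : descendTo F ℰp J (J + 1) (Nat.le_succ J) ⁻¹' s =
        (BlockAveraging.blockAvg (P := F.P (J + 1)) (j := 0) ℰp).avg ⁻¹'
          ((fieldShift hsh : GaugeField (F.PP F.m (J + 1)) 1 (Matrix.specialUnitaryGroup (Fin 2) ℂ) →
            GaugeField (F.PP F.m J) 0 (Matrix.specialUnitaryGroup (Fin 2) ℂ)) ⁻¹' s) := by
      ext U
      simp only [Set.mem_preimage]
      rw [descendTo_succ F ℰp J U]
      exact Iff.rfl
    calc fieldMeasure (F.P (J + 1)) 0 (Matrix.specialUnitaryGroup (Fin 2) ℂ) (descendTo F ℰp J (J + 1) (Nat.le_succ J) ⁻¹' s)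
        = fieldMeasure (F.P (J + 1)) 0 (Matrix.specialUnitaryGroup (Fin 2) ℂ)
            ((BlockAveraging.blockAvg (P := F.P (J + 1)) (j := 0) ℰp).avg ⁻¹'
              ((fieldShift hsh : GaugeField (F.PP F.m (J + 1)) 1 (Matrix.specialUnitaryGroup (Fin 2) ℂ) →
                GaugeField (F.PP F.m J) 0 (Matrix.specialUnitaryGroup (Fin 2) ℂ)) ⁻¹' s)) := by rw [hpre]
      _ = Measure.map (BlockAveraging.blockAvg (P := F.P (J + 1)) (j := 0) ℰp).avg
            (fieldMeasure (F.P (J + 1)) 0 (Matrix.specialUnitaryGroup (Fin 2) ℂ))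
            ((fieldShift hsh : GaugeField (F.PP F.m (J + 1)) 1 (Matrix.specialUnitaryGroup (Fin 2) ℂ) →
              GaugeField (F.PP F.m J) 0 (Matrix.specialUnitaryGroup (Fin 2) ℂ)) ⁻¹' s) :=
          (Measure.map_apply (measurable_blockAvg F (J + 1) 0) hT).symm
      _ ≤ (N • fieldMeasure (F.P (J + 1)) 1 (Matrix.specialUnitaryGroup (Fin 2) ℂ))
            ((fieldShift hsh : GaugeField (F.PP F.m (J + 1)) 1 (Matrix.specialUnitaryGroup (Fin 2) ℂ) →
              GaugeField (F.PP F.m J) 0 (Matrix.specialUnitaryGroup (Fin 2) ℂ)) ⁻¹' s) := Measure.le_iff'.mp himg' _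
      _ = N * fieldMeasure (F.P J) 0 (Matrix.specialUnitaryGroup (Fin 2) ℂ) s := by
          rw [Measure.smul_apply, smul_eq_mul]
          congr 1
          exact (measurePreserving_fieldShift (G := Matrix.specialUnitaryGroup (Fin 2) ℂ) hsh).measure_preimage hs.nullMeasurableSet
  -- assemble setwise
  refine Measure.le_iff.mpr fun s hs => ?_
  rw [Measure.map_apply hD hs, Measure.smul_apply, smul_eq_mul, mul_assoc]
  exact (hgibbs _).trans (mul_le_mul' le_rfl (hdU s hs))

/-- ★★ **THE DOMINATION LETTER OF ✓`floor_of_wreg` AT DEPTH ONE, DISCHARGED**: for `γ ≥ 0` and every `J` there is a real `C > 0` with `Gibbs_{J+1}(D_{J,J+1}⁻¹B) ≤ ofReal C·dU_J(B)`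
for EVERY measurable `B` (no window needed). [cite: Balaban1987RG1, (0.4) and (0.11) p.253; Balaban1985UV3, (5) p.256] -/
theorem dominated_depthOne (hγ : 0 ≤ γ) (J : ℕ) :
    ∃ C : ℝ, 0 < C ∧ ∀ B : Set (GaugeField (F.P J) 0 (Matrix.specialUnitaryGroup (Fin 2) ℂ)), MeasurableSet B →
      gibbsK F ℰp γ (J + 1) (descendTo F ℰp J (J + 1) (Nat.le_succ J) ⁻¹' B) ≤
        ENNReal.ofReal C * fieldMeasure (F.P J) 0 (Matrix.specialUnitaryGroup (Fin 2) ℂ) B := by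
  obtain ⟨C, hC, hle⟩ := map_descendTo_succ_gibbsK_le_smul F hγ J
  have hD : Measurable (descendTo F ℰp J (J + 1) (Nat.le_succ J)) := measurable_descendTo F ℰp measurableE_ℰp (Nat.le_succ J)
  refine ⟨C.toReal + 1, by positivity, fun B hB => ?_⟩
  have h1 := Measure.le_iff.mp hle B hB
  rw [Measure.map_apply hD hB, Measure.smul_apply, smul_eq_mul] at h1
  refine h1.trans (mul_le_mul' ?_ le_rfl)
  calc C = ENNReal.ofReal C.toReal := (ENNReal.ofReal_toReal hC).symm
    _ ≤ ENNReal.ofReal (C.toReal + 1) := ENNReal.ofReal_le_ofReal (by linarith)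

end Domination

/-! ## §2 The small-`J` floor at depth one, unconditionally -/

section Floor

/-- ★★★ **FLOOR₁∘(J), UNCONDITIONALLY**: for every block size `L` and profile `b₀, p₀ > 0` there is `γ₁ > 0` (WREG's, capped at `1`) such that for every family `F` with `F.L = L`, every
`0 < γ ≤ γ₁`, every level `J` and every interior fraction `0 < c < 1` there is `q > 0` with `ofReal q·Gibbs_{J+1}(D⁻¹B) ≤ Gibbs_{J+1}(D⁻¹B ∩ histGood(θBal b₀) (J+1) J)` for every measurable
`B` inside the interior window `W_J(c·b₀)` — px21 g13's ✓`floor_of_wreg` at `K := J+1` with its one domination letter supplied by §1 `dominated_depthOne`.  This is the FLOOR conjunct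
of ✓O ∕ ✓P ∕ ✓`…PrintedForm` ∕ ✓`…PrintedLeaf` (there for `J < J₀`; here for every `J`), and LINE g22-2's PERS₁∘-class positivity at `K = J+1`.  `q` depends on `(F, γ, J, c)`.
[cite: Balaban1985UV3, (2) p.256, (7) p.257 and (38)-(40) p.266; Balaban1987RG1, (0.4) p.253] -/
theorem floor_depthOne :
    ∀ (L : ℕ) (b₀ p₀ : ℝ), 0 < b₀ → 0 < p₀ → ∃ γ₁ : ℝ, 0 < γ₁ ∧ ∀ (F : T3Family) (γ : ℝ), F.L = L → 0 < γ → γ ≤ γ₁ →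
      ∀ (J : ℕ) (c : ℝ), 0 < c → c < 1 →
        ∃ q : ℝ, 0 < q ∧ ∀ B : Set (GaugeField (F.P J) 0 (Matrix.specialUnitaryGroup (Fin 2) ℂ)), MeasurableSet B →
          B ⊆ {U | PlaqSmall (θBal F.L γ (c * b₀) p₀ J) U} →
          ENNReal.ofReal q * gibbsK F ℰp γ (J + 1) (descendTo F ℰp J (J + 1) (Nat.le_succ J) ⁻¹' B) ≤
            gibbsK F ℰp γ (J + 1) (descendTo F ℰp J (J + 1) (Nat.le_succ J) ⁻¹' B ∩ histGood F ℰp (θBal F.L γ b₀ p₀) (J + 1) J) := by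
  intro L b₀ p₀ hb₀ hp₀
  obtain ⟨γ₁, hγ₁, hW⟩ := floor_of_wreg L b₀ p₀ hb₀ hp₀
  refine ⟨γ₁, hγ₁, fun F γ hFL hγ hγle J c hc0 hc1 => ?_⟩
  obtain ⟨C, hC, hdom⟩ := dominated_depthOne F hγ.le J
  exact hW F γ hFL hγ hγle J (J + 1) (Nat.le_succ J) c hc0 hc1 C hC (fun B hB _ => hdom B hB)

end Floor

/-! ## §3 The leaf without the floor: ONE fibrewise per-plaquette tail in print's currency ⇒ ⟨COND-ODDS₁∘⟩ ⇒ TAILSUP₁∘ -/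

section Leaf

/-- ★★★ **THE LEAF WITHOUT THE FLOOR: ⟨FIBRE-TAIL-PRINTED₁⟩ ⇒ ✓K's ⟨COND-ODDS₁∘⟩.**  Hypothesis (TAILSUP₁∘'s quantifier prefix, then; all letters after `F, γ`): constants `C` (any sign),
`A : ℕ`, `cT > 0` and, for every `J`, fine plaquette `p ∈ T_{J+1}`, for `(dU_{J+1}.map D)`-a.e. datum `V` in the INTERIOR window (`κ_V = condLaw dU_{J+1} D_{J,J+1} V`):
(TAIL₁) `∫⁻_{θBal L γ b₀ p₀ (J+1) ≤ dist1 U(∂p)} boltzmann dκ_V ≤ ofReal(C·β_{J+1}^A·e^{−cT·pFun b₀ p₀ (√(γL^{−(J+1)}))²})·∫⁻ boltzmann dκ_V`.  NO floor, NO regime split, NO moment,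
NO profile.  Proof: ✓`…PrintedLeaf.condGoodOddsDepthOneInt_of_fibreTailPrinted_floor` with its FLOOR conjunct supplied by §2 `floor_depthOne` (`c₀ ↦ min c₀ ½` makes `c < 1`;
`γ₁ ↦ min γ₁ γ₁^{WREG}`). [cite: Balaban1985UV3, (2) p.256, (7) p.257, (38)-(40) p.266 and (71) p.273] -/
theorem condGoodOddsDepthOneInt_of_fibreTailPrinted
    (h : ∀ (L : ℕ), ∃ c₀ : ℝ, 0 < c₀ ∧ c₀ ≤ 1 ∧ ∀ (c : ℝ), 0 < c → c ≤ c₀ → ∃ pS : ℝ, ∀ (b₀ p₀ : ℝ), 0 < b₀ → pS ≤ p₀ → 0 < p₀ →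
      ∃ γ₁ : ℝ, 0 < γ₁ ∧ ∀ (F : T3Family) (γ : ℝ), F.L = L → 0 < γ → γ ≤ γ₁ →
        ∃ (C : ℝ) (A : ℕ) (cT : ℝ), 0 < cT ∧
          ∀ (J : ℕ) (p : Plaq (F.P (J + 1)) 0),
            ∀ᵐ V ∂((fieldMeasure (F.P (J + 1)) 0 (Matrix.specialUnitaryGroup (Fin 2) ℂ)).map (descendTo F ℰp J (J + 1) (Nat.le_succ J))),
              PlaqSmall (θBal F.L γ (c * b₀) p₀ J) V →
                ∫⁻ U in {U | θBal F.L γ b₀ p₀ (J + 1) ≤ dist1 (GaugeField.plaqHol U p)},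
                    ENNReal.ofReal (boltzmann (F.P (J + 1)) ((F.scheme ℰp γ).β (J + 1)) U)
                    ∂(condLaw (fieldMeasure (F.P (J + 1)) 0 (Matrix.specialUnitaryGroup (Fin 2) ℂ)) (descendTo F ℰp J (J + 1) (Nat.le_succ J)) V) ≤
                  ENNReal.ofReal (C * (F.scheme ℰp γ).β (J + 1) ^ A *
                      Real.exp (-(cT * B10.pFun b₀ p₀ (Real.sqrt (γ * ((F.L : ℝ)⁻¹) ^ (J + 1))) ^ 2))) *
                    ∫⁻ U, ENNReal.ofReal (boltzmann (F.P (J + 1)) ((F.scheme ℰp γ).β (J + 1)) U)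
                      ∂(condLaw (fieldMeasure (F.P (J + 1)) 0 (Matrix.specialUnitaryGroup (Fin 2) ℂ)) (descendTo F ℰp J (J + 1) (Nat.le_succ J)) V)) :
    ∀ (L : ℕ), ∃ c₀ : ℝ, 0 < c₀ ∧ c₀ ≤ 1 ∧ ∀ (c : ℝ), 0 < c → c ≤ c₀ → ∃ pS : ℝ, ∀ (b₀ p₀ : ℝ), 0 < b₀ → pS ≤ p₀ → 0 < p₀ →
      ∃ γ₁ : ℝ, 0 < γ₁ ∧ ∀ (F : T3Family) (γ : ℝ), F.L = L → 0 < γ → γ ≤ γ₁ →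
        ∃ τ : ℕ → ℝ, (∀ J, 0 ≤ τ J) ∧ (∀ a : ℕ, Tendsto (fun J : ℕ => ((J : ℝ) + 1) ^ a * τ J) atTop (𝓝 0)) ∧
          ∀ (J : ℕ) (B : Set (GaugeField (F.P J) 0 (Matrix.specialUnitaryGroup (Fin 2) ℂ))), MeasurableSet B →
            B ⊆ {U | PlaqSmall (θBal F.L γ (c * b₀) p₀ J) U} →
            gibbsK F ℰp γ (J + 1) (descendTo F ℰp J (J + 1) (Nat.le_succ J) ⁻¹' B) ≤
              ENNReal.ofReal (Real.exp (τ J)) *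
                gibbsK F ℰp γ (J + 1) (descendTo F ℰp J (J + 1) (Nat.le_succ J) ⁻¹' B ∩ histGood F ℰp (θBal F.L γ b₀ p₀) (J + 1) J) := by
  refine condGoodOddsDepthOneInt_of_fibreTailPrinted_floor fun L => ?_
  obtain ⟨c₀, hc₀, hc₀1, hc⟩ := h L
  refine ⟨min c₀ (1 / 2), lt_min hc₀ (by norm_num), (min_le_left _ _).trans hc₀1, fun c hcpos hcle => ?_⟩
  have hcc₀ : c ≤ c₀ := hcle.trans (min_le_left _ _)
  have hc1 : c < 1 := lt_of_le_of_lt (hcle.trans (min_le_right _ _)) (by norm_num)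
  obtain ⟨pS, hpS⟩ := hc c hcpos hcc₀
  refine ⟨pS, fun b₀ p₀ hb₀ hpS' hp₀ => ?_⟩
  obtain ⟨γ₁, hγ₁, hγ₁F⟩ := hpS b₀ p₀ hb₀ hpS' hp₀
  obtain ⟨γ₂, hγ₂, hfloor⟩ := floor_depthOne L b₀ p₀ hb₀ hp₀
  refine ⟨min γ₁ γ₂, lt_min hγ₁ hγ₂, fun F γ hFL hγ hγle => ?_⟩
  obtain ⟨C, A, cT, hcT, htail⟩ := hγ₁F F γ hFL hγ (hγle.trans (min_le_left _ _))
  exact ⟨C, A, cT, hcT, fun J => hfloor F γ hFL hγ (hγle.trans (min_le_right _ _)) J c hcpos hc1, htail⟩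

/-- ★★★ **THE LEAF WITHOUT THE FLOOR ⇒ TAILSUP₁∘** (LINE g21-2 v1.4's interior row `RunPairOrgan.OneLoop.WindowOddsSupDepthOneIntCan`, text verbatim): ⟨FIBRE-TAIL-PRINTED₁⟩, then ✓K
`windowOddsSupDepthOneIntCan_of_condGoodOddsDepthOneInt`.  AFTER THIS FILE THE HAND'S RESIDUE FOR TAILSUP₁∘ IS ONE LETTER: the per-plaquette window-exit fraction of the Boltzmann-tilted
conditional Haar law one level deep, in print's currency (chart + convexity).  HONEST SCOPE: that letter is the HYPOTHESIS; nothing upstream is proved.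
[cite: Balaban1985UV3, (2) p.256, (7) p.257, (38)-(40) p.266 and (71) p.273] -/
theorem windowOddsSupDepthOneInt_of_fibreTailPrinted
    (h : ∀ (L : ℕ), ∃ c₀ : ℝ, 0 < c₀ ∧ c₀ ≤ 1 ∧ ∀ (c : ℝ), 0 < c → c ≤ c₀ → ∃ pS : ℝ, ∀ (b₀ p₀ : ℝ), 0 < b₀ → pS ≤ p₀ → 0 < p₀ →
      ∃ γ₁ : ℝ, 0 < γ₁ ∧ ∀ (F : T3Family) (γ : ℝ), F.L = L → 0 < γ → γ ≤ γ₁ →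
        ∃ (C : ℝ) (A : ℕ) (cT : ℝ), 0 < cT ∧
          ∀ (J : ℕ) (p : Plaq (F.P (J + 1)) 0),
            ∀ᵐ V ∂((fieldMeasure (F.P (J + 1)) 0 (Matrix.specialUnitaryGroup (Fin 2) ℂ)).map (descendTo F ℰp J (J + 1) (Nat.le_succ J))),
              PlaqSmall (θBal F.L γ (c * b₀) p₀ J) V →
                ∫⁻ U in {U | θBal F.L γ b₀ p₀ (J + 1) ≤ dist1 (GaugeField.plaqHol U p)},
                    ENNReal.ofReal (boltzmann (F.P (J + 1)) ((F.scheme ℰp γ).β (J + 1)) U)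
                    ∂(condLaw (fieldMeasure (F.P (J + 1)) 0 (Matrix.specialUnitaryGroup (Fin 2) ℂ)) (descendTo F ℰp J (J + 1) (Nat.le_succ J)) V) ≤
                  ENNReal.ofReal (C * (F.scheme ℰp γ).β (J + 1) ^ A *
                      Real.exp (-(cT * B10.pFun b₀ p₀ (Real.sqrt (γ * ((F.L : ℝ)⁻¹) ^ (J + 1))) ^ 2))) *
                    ∫⁻ U, ENNReal.ofReal (boltzmann (F.P (J + 1)) ((F.scheme ℰp γ).β (J + 1)) U)
                      ∂(condLaw (fieldMeasure (F.P (J + 1)) 0 (Matrix.specialUnitaryGroup (Fin 2) ℂ)) (descendTo F ℰp J (J + 1) (Nat.le_succ J)) V)) :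
    ∀ (L : ℕ), ∃ c₀ : ℝ, 0 < c₀ ∧ c₀ ≤ 1 ∧ ∀ (c : ℝ), 0 < c → c ≤ c₀ → ∃ pS : ℝ, ∀ (b₀ p₀ : ℝ), 0 < b₀ → pS ≤ p₀ → 0 < p₀ →
    ∃ γ₁ : ℝ, 0 < γ₁ ∧ ∀ (F : T3Family) (γ : ℝ), F.L = L → 0 < γ → γ ≤ γ₁ →
      ∃ τ : ℕ → ℝ, (∀ J, 0 ≤ τ J) ∧ (∀ a : ℕ, Tendsto (fun J : ℕ => ((J : ℝ) + 1) ^ a * τ J) atTop (𝓝 0)) ∧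
        ∀ (ν : ℕ → (j : ℕ) → Measure (GaugeField (F.P j) 0 (Matrix.specialUnitaryGroup (Fin 2) ℂ))),
          (∀ K, ν K K = T4GenFunBounds.gibbsMeasure (F.P K) ((F.scheme ℰp γ).β K)) →
          (∀ K j, j < K → ν K j = Measure.map (descend F ℰp j) (ν K (j + 1))) →
          ∀ (J : ℕ) (ρ : GaugeField (F.P J) 0 (Matrix.specialUnitaryGroup (Fin 2) ℂ) → ℝ),
            (∀ U, PlaqSmall (θBal F.L γ (c * b₀) p₀ J) U → 0 < ρ U) →
            ν (J + 1) J = (fieldMeasure _ _ _).withDensity (fun U => ENNReal.ofReal (ρ U)) →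
            ContinuousOn ρ {U | PlaqSmall (θBal F.L γ (c * b₀) p₀ J) U} →
            (∀ U : GaugeField (F.P J) 0 (Matrix.specialUnitaryGroup (Fin 2) ℂ), PlaqSmall (θBal F.L γ (c * b₀) p₀ J) U →
                0 < heightDensityCan F γ (Nat.le_succ J) (histGood F ℰp (θBal F.L γ b₀ p₀) (J + 1) J) U) →
            ∃ a₀ : ℝ, ∀ U : GaugeField (F.P J) 0 (Matrix.specialUnitaryGroup (Fin 2) ℂ), PlaqSmall (θBal F.L γ (c * b₀) p₀ J) U →
              0 ≤ Real.log (ρ U) - a₀ - Real.log (heightDensityCan F γ (Nat.le_succ J) (histGood F ℰp (θBal F.L γ b₀ p₀) (J + 1) J) U) ∧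
              Real.log (ρ U) - a₀ - Real.log (heightDensityCan F γ (Nat.le_succ J) (histGood F ℰp (θBal F.L γ b₀ p₀) (J + 1) J) U) ≤ τ J :=
  FluctuationComparisonRegPrIntLSupTailReductionInt.windowOddsSupDepthOneIntCan_of_condGoodOddsDepthOneInt
    (condGoodOddsDepthOneInt_of_fibreTailPrinted h)

end Leaf

/-! ## §4 (v1.1 APPEND) The two-regime fibrewise door without the floor: (TAIL) in a chart radius + (MOMENT-LIN) ⇒ ⟨COND-ODDS₁∘⟩ ⇒ TAILSUP₁∘ -/

section TwoRegime

/-- ★★★ **TWO REGIMES, FIBREWISE, WITHOUT THE FLOOR: ⟨FIBRE-TAIL-PRINTED₁∘ + MOMENT-LIN₁∘⟩ ⇒ ✓K's ⟨COND-ODDS₁∘⟩** — ✓`…PrintedForm.condGoodOddsDepthOneInt_of_fibreTailPrinted_linearMoment_floor`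
with its FLOOR conjunct supplied by §2 `floor_depthOne`.  Hypothesis (TAILSUP₁∘'s prefix, then; all letters after `F, γ`): a splitting radius `δ₀ ≥ 0`, constants `C` (any sign), `A : ℕ`,
`cT > 0`, a slope `cM < δ₀²∕4`, and for every `J`, `p ∈ T_{J+1}`, a.e. interior datum `V`: (TAIL) `∫⁻_{θBal_{J+1} ≤ dist1 U(∂p) < δ₀} boltzmann dκ_V ≤ ofReal(C·β_{J+1}^A·e^{−cT·p(g_{J+1})²})·∫⁻ boltzmann dκ_V`
and (MOMENT-LIN) `⨍ β_{J+1}(1 − Re tr U(∂p)) d(κ_V.withDensity e^{−β_{J+1}A_{¬p}}) ≤ cM·β_{J+1}` — the shape a (TAIL) hand confined to a chart radius `δ₀ ≤ 2` wants (for `δ₀ ≥ 3` use §3: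
the far regime is empty and (MOMENT-LIN) is class-trivial, ✓`…PrintedLeaf.farMomentRow_two_mul_beta`). [cite: Balaban1985UV3, (2) p.256, (7) p.257, (38)-(40) p.266 and (67)-(71) p.273] -/
theorem condGoodOddsDepthOneInt_of_fibreTailPrinted_linearMoment
    (h : ∀ (L : ℕ), ∃ c₀ : ℝ, 0 < c₀ ∧ c₀ ≤ 1 ∧ ∀ (c : ℝ), 0 < c → c ≤ c₀ → ∃ pS : ℝ, ∀ (b₀ p₀ : ℝ), 0 < b₀ → pS ≤ p₀ → 0 < p₀ →
      ∃ γ₁ : ℝ, 0 < γ₁ ∧ ∀ (F : T3Family) (γ : ℝ), F.L = L → 0 < γ → γ ≤ γ₁ →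
        ∃ (δ₀ C : ℝ) (A : ℕ) (cT cM : ℝ), 0 ≤ δ₀ ∧ 0 < cT ∧ cM < δ₀ ^ 2 / 4 ∧
          (∀ (J : ℕ) (p : Plaq (F.P (J + 1)) 0),
            ∀ᵐ V ∂((fieldMeasure (F.P (J + 1)) 0 (Matrix.specialUnitaryGroup (Fin 2) ℂ)).map (descendTo F ℰp J (J + 1) (Nat.le_succ J))),
              PlaqSmall (θBal F.L γ (c * b₀) p₀ J) V →
                ∫⁻ U in {U | θBal F.L γ b₀ p₀ (J + 1) ≤ dist1 (GaugeField.plaqHol U p) ∧ dist1 (GaugeField.plaqHol U p) < δ₀},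
                    ENNReal.ofReal (boltzmann (F.P (J + 1)) ((F.scheme ℰp γ).β (J + 1)) U)
                    ∂(condLaw (fieldMeasure (F.P (J + 1)) 0 (Matrix.specialUnitaryGroup (Fin 2) ℂ)) (descendTo F ℰp J (J + 1) (Nat.le_succ J)) V) ≤
                  ENNReal.ofReal (C * (F.scheme ℰp γ).β (J + 1) ^ A *
                      Real.exp (-(cT * B10.pFun b₀ p₀ (Real.sqrt (γ * ((F.L : ℝ)⁻¹) ^ (J + 1))) ^ 2))) *
                    ∫⁻ U, ENNReal.ofReal (boltzmann (F.P (J + 1)) ((F.scheme ℰp γ).β (J + 1)) U)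
                      ∂(condLaw (fieldMeasure (F.P (J + 1)) 0 (Matrix.specialUnitaryGroup (Fin 2) ℂ)) (descendTo F ℰp J (J + 1) (Nat.le_succ J)) V)) ∧
          (∀ (J : ℕ) (p : Plaq (F.P (J + 1)) 0),
            ∀ᵐ V ∂((fieldMeasure (F.P (J + 1)) 0 (Matrix.specialUnitaryGroup (Fin 2) ℂ)).map (descendTo F ℰp J (J + 1) (Nat.le_succ J))),
              PlaqSmall (θBal F.L γ (c * b₀) p₀ J) V →
                ⨍ U, (F.scheme ℰp γ).β (J + 1) * (1 - reTr (GaugeField.plaqHol U p))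
                  ∂((condLaw (fieldMeasure (F.P (J + 1)) 0 (Matrix.specialUnitaryGroup (Fin 2) ℂ)) (descendTo F ℰp J (J + 1) (Nat.le_succ J)) V).withDensity
                    fun U => ENNReal.ofReal (Real.exp (-((F.scheme ℰp γ).β (J + 1) *
                      (wilsonAction4 U - (1 - reTr (GaugeField.plaqHol U p))))))) ≤ cM * (F.scheme ℰp γ).β (J + 1))) :
    ∀ (L : ℕ), ∃ c₀ : ℝ, 0 < c₀ ∧ c₀ ≤ 1 ∧ ∀ (c : ℝ), 0 < c → c ≤ c₀ → ∃ pS : ℝ, ∀ (b₀ p₀ : ℝ), 0 < b₀ → pS ≤ p₀ → 0 < p₀ →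
      ∃ γ₁ : ℝ, 0 < γ₁ ∧ ∀ (F : T3Family) (γ : ℝ), F.L = L → 0 < γ → γ ≤ γ₁ →
        ∃ τ : ℕ → ℝ, (∀ J, 0 ≤ τ J) ∧ (∀ a : ℕ, Tendsto (fun J : ℕ => ((J : ℝ) + 1) ^ a * τ J) atTop (𝓝 0)) ∧
          ∀ (J : ℕ) (B : Set (GaugeField (F.P J) 0 (Matrix.specialUnitaryGroup (Fin 2) ℂ))), MeasurableSet B →
            B ⊆ {U | PlaqSmall (θBal F.L γ (c * b₀) p₀ J) U} →
            gibbsK F ℰp γ (J + 1) (descendTo F ℰp J (J + 1) (Nat.le_succ J) ⁻¹' B) ≤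
              ENNReal.ofReal (Real.exp (τ J)) *
                gibbsK F ℰp γ (J + 1) (descendTo F ℰp J (J + 1) (Nat.le_succ J) ⁻¹' B ∩ histGood F ℰp (θBal F.L γ b₀ p₀) (J + 1) J) := by
  refine FluctuationComparisonRegPrIntLSupTailCoverUnionPrintedForm.condGoodOddsDepthOneInt_of_fibreTailPrinted_linearMoment_floor fun L => ?_
  obtain ⟨c₀, hc₀, hc₀1, hc⟩ := h L
  refine ⟨min c₀ (1 / 2), lt_min hc₀ (by norm_num), (min_le_left _ _).trans hc₀1, fun c hcpos hcle => ?_⟩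
  have hcc₀ : c ≤ c₀ := hcle.trans (min_le_left _ _)
  have hc1 : c < 1 := lt_of_le_of_lt (hcle.trans (min_le_right _ _)) (by norm_num)
  obtain ⟨pS, hpS⟩ := hc c hcpos hcc₀
  refine ⟨pS, fun b₀ p₀ hb₀ hpS' hp₀ => ?_⟩
  obtain ⟨γ₁, hγ₁, hγ₁F⟩ := hpS b₀ p₀ hb₀ hpS' hp₀
  obtain ⟨γ₂, hγ₂, hfloor⟩ := floor_depthOne L b₀ p₀ hb₀ hp₀
  refine ⟨min γ₁ γ₂, lt_min hγ₁ hγ₂, fun F γ hFL hγ hγle => ?_⟩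
  obtain ⟨δ₀, C, A, cT, cM, hδ₀, hcT, hκ, htail, hmom⟩ := hγ₁F F γ hFL hγ (hγle.trans (min_le_left _ _))
  exact ⟨δ₀, C, A, cT, cM, hδ₀, hcT, hκ, fun J => hfloor F γ hFL hγ (hγle.trans (min_le_right _ _)) J c hcpos hc1, htail, hmom⟩

/-- ★★★ **⟨FIBRE-TAIL-PRINTED₁∘ + MOMENT-LIN₁∘⟩ ⇒ TAILSUP₁∘, WITHOUT THE FLOOR** (LINE g21-2 v1.4's interior row `RunPairOrgan.OneLoop.WindowOddsSupDepthOneIntCan`, text verbatim): §4 then ✓K.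
HONEST SCOPE: (TAIL) and (MOMENT-LIN) are the HYPOTHESIS; nothing upstream is proved. [cite: Balaban1985UV3, (2) p.256, (7) p.257, (38)-(40) p.266 and (67)-(71) p.273] -/
theorem windowOddsSupDepthOneInt_of_fibreTailPrinted_linearMoment
    (h : ∀ (L : ℕ), ∃ c₀ : ℝ, 0 < c₀ ∧ c₀ ≤ 1 ∧ ∀ (c : ℝ), 0 < c → c ≤ c₀ → ∃ pS : ℝ, ∀ (b₀ p₀ : ℝ), 0 < b₀ → pS ≤ p₀ → 0 < p₀ →
      ∃ γ₁ : ℝ, 0 < γ₁ ∧ ∀ (F : T3Family) (γ : ℝ), F.L = L → 0 < γ → γ ≤ γ₁ →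
        ∃ (δ₀ C : ℝ) (A : ℕ) (cT cM : ℝ), 0 ≤ δ₀ ∧ 0 < cT ∧ cM < δ₀ ^ 2 / 4 ∧
          (∀ (J : ℕ) (p : Plaq (F.P (J + 1)) 0),
            ∀ᵐ V ∂((fieldMeasure (F.P (J + 1)) 0 (Matrix.specialUnitaryGroup (Fin 2) ℂ)).map (descendTo F ℰp J (J + 1) (Nat.le_succ J))),
              PlaqSmall (θBal F.L γ (c * b₀) p₀ J) V →
                ∫⁻ U in {U | θBal F.L γ b₀ p₀ (J + 1) ≤ dist1 (GaugeField.plaqHol U p) ∧ dist1 (GaugeField.plaqHol U p) < δ₀},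
                    ENNReal.ofReal (boltzmann (F.P (J + 1)) ((F.scheme ℰp γ).β (J + 1)) U)
                    ∂(condLaw (fieldMeasure (F.P (J + 1)) 0 (Matrix.specialUnitaryGroup (Fin 2) ℂ)) (descendTo F ℰp J (J + 1) (Nat.le_succ J)) V) ≤
                  ENNReal.ofReal (C * (F.scheme ℰp γ).β (J + 1) ^ A *
                      Real.exp (-(cT * B10.pFun b₀ p₀ (Real.sqrt (γ * ((F.L : ℝ)⁻¹) ^ (J + 1))) ^ 2))) *
                    ∫⁻ U, ENNReal.ofReal (boltzmann (F.P (J + 1)) ((F.scheme ℰp γ).β (J + 1)) U)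
                      ∂(condLaw (fieldMeasure (F.P (J + 1)) 0 (Matrix.specialUnitaryGroup (Fin 2) ℂ)) (descendTo F ℰp J (J + 1) (Nat.le_succ J)) V)) ∧
          (∀ (J : ℕ) (p : Plaq (F.P (J + 1)) 0),
            ∀ᵐ V ∂((fieldMeasure (F.P (J + 1)) 0 (Matrix.specialUnitaryGroup (Fin 2) ℂ)).map (descendTo F ℰp J (J + 1) (Nat.le_succ J))),
              PlaqSmall (θBal F.L γ (c * b₀) p₀ J) V →
                ⨍ U, (F.scheme ℰp γ).β (J + 1) * (1 - reTr (GaugeField.plaqHol U p))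
                  ∂((condLaw (fieldMeasure (F.P (J + 1)) 0 (Matrix.specialUnitaryGroup (Fin 2) ℂ)) (descendTo F ℰp J (J + 1) (Nat.le_succ J)) V).withDensity
                    fun U => ENNReal.ofReal (Real.exp (-((F.scheme ℰp γ).β (J + 1) *
                      (wilsonAction4 U - (1 - reTr (GaugeField.plaqHol U p))))))) ≤ cM * (F.scheme ℰp γ).β (J + 1))) :
    ∀ (L : ℕ), ∃ c₀ : ℝ, 0 < c₀ ∧ c₀ ≤ 1 ∧ ∀ (c : ℝ), 0 < c → c ≤ c₀ → ∃ pS : ℝ, ∀ (b₀ p₀ : ℝ), 0 < b₀ → pS ≤ p₀ → 0 < p₀ →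
    ∃ γ₁ : ℝ, 0 < γ₁ ∧ ∀ (F : T3Family) (γ : ℝ), F.L = L → 0 < γ → γ ≤ γ₁ →
      ∃ τ : ℕ → ℝ, (∀ J, 0 ≤ τ J) ∧ (∀ a : ℕ, Tendsto (fun J : ℕ => ((J : ℝ) + 1) ^ a * τ J) atTop (𝓝 0)) ∧
        ∀ (ν : ℕ → (j : ℕ) → Measure (GaugeField (F.P j) 0 (Matrix.specialUnitaryGroup (Fin 2) ℂ))),
          (∀ K, ν K K = T4GenFunBounds.gibbsMeasure (F.P K) ((F.scheme ℰp γ).β K)) →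
          (∀ K j, j < K → ν K j = Measure.map (descend F ℰp j) (ν K (j + 1))) →
          ∀ (J : ℕ) (ρ : GaugeField (F.P J) 0 (Matrix.specialUnitaryGroup (Fin 2) ℂ) → ℝ),
            (∀ U, PlaqSmall (θBal F.L γ (c * b₀) p₀ J) U → 0 < ρ U) →
            ν (J + 1) J = (fieldMeasure _ _ _).withDensity (fun U => ENNReal.ofReal (ρ U)) →
            ContinuousOn ρ {U | PlaqSmall (θBal F.L γ (c * b₀) p₀ J) U} →
            (∀ U : GaugeField (F.P J) 0 (Matrix.specialUnitaryGroup (Fin 2) ℂ), PlaqSmall (θBal F.L γ (c * b₀) p₀ J) U →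
                0 < heightDensityCan F γ (Nat.le_succ J) (histGood F ℰp (θBal F.L γ b₀ p₀) (J + 1) J) U) →
            ∃ a₀ : ℝ, ∀ U : GaugeField (F.P J) 0 (Matrix.specialUnitaryGroup (Fin 2) ℂ), PlaqSmall (θBal F.L γ (c * b₀) p₀ J) U →
              0 ≤ Real.log (ρ U) - a₀ - Real.log (heightDensityCan F γ (Nat.le_succ J) (histGood F ℰp (θBal F.L γ b₀ p₀) (J + 1) J) U) ∧
              Real.log (ρ U) - a₀ - Real.log (heightDensityCan F γ (Nat.le_succ J) (histGood F ℰp (θBal F.L γ b₀ p₀) (J + 1) J) U) ≤ τ J :=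
  FluctuationComparisonRegPrIntLSupTailReductionInt.windowOddsSupDepthOneIntCan_of_condGoodOddsDepthOneInt
    (condGoodOddsDepthOneInt_of_fibreTailPrinted_linearMoment h)

end TwoRegime

end Summit.QuantumFields.YangMills.Theorems.FluctuationComparisonRegPrIntLSupTailFloorDepthOne

end
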